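/-
Copyright (c) 2026. All rights reserved.
Released under Apache 2.0 license as described in the file LICENSE.
Authors: abc-iut cell, seat abc-iut-w5-d226 (gen 2; NON-VACUITY witness for Prop 4.2 (i) vs Rmk 4.2.1 at
the model, sub-DAG `AbsTopIII:Prop4.2` rows P42.i/L10–L12 of plan/L4/SUBDAG-AbsTopIII-Prop42.md).
-/
import Literature.AnabelianGeometry.AbsoluteAnabelian.ArchimedeanHolPairsRigidityProofs
import Literature.AnabelianGeometry.AbsoluteAnabelian.AbsTopIII.AutHolLogFrobeniusModelProofs
import Mathlib.Data.PNat.Basic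
import HarnessLib

/-!
# [AbsTopIII] Prop 4.2 (i) and Rmk 4.2.1 hold SIMULTANEOUSLY and non-trivially at an instance of the
# interface modelled on the finite étale self-maps `z ↦ c·zⁿ` of `ℂ^×` (kernel witness)

S. Mochizuki, *Topics in absolute anabelian geometry III*, Prop 4.2 (i) p. 105 ("the categories `EA`,
`𝒞^hol_T = 𝒞̲^hol_T` … are id-rigid") and Rmk 4.2.1 p. 106 ("the id-rigidity portion of Proposition 4.2,
(i), is [as is easily verifed] false for the '`𝒞̲̲`' and '`𝒞̲̲̲`' versions"), kurims manuscript (lit key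
`paper:url-5493eb38cbb7`; bib key `MochizukiAbsTopIII2015`).  PROOF-ONLY (nothing is declared; the
witness is built inside the proof).

The abstract layer of the cell's §4 model (abc-iut-L4-t10's interface `AutHolFieldFunctor` = Cor 2.7 (e)
+ functoriality; `𝒞^hol_TF = HolTFPair 𝔄`; abc-iut-w5-d226's `𝒞^hol_T = HolMonoidPair 𝔄 T`) proves
Prop 4.2 (i)'s id-rigidity of `𝒞^hol_T` FROM `IsIdRigid EA`, and Rmk 4.2.1's failure for the groupoid
versions FROM a nontrivial central automorphism in `EA` (`ArchimedeanHolPairsRigidityProofs.lean`).  The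
one-object witness of `AutHolLogFrobeniusModelProofs` (`EA = Discrete PUnit`) has no non-identity
morphism, so there both hypotheses are degenerate.  Here: an instance `𝔄` whose `EA` is the one-object
category with endomorphism monoid `{z ↦ c·zⁿ : c ∈ ℂ^×, n ≥ 1}` under composition —
`(d·zᵐ) ∘ (c·zⁿ) = (d cᵐ)·zⁿᵐ` (`puncturedPlane_comp_apply`: these ARE the composites of the self-maps of
`ℂ^×`, the finite étale holomorphic self-coverings `z ↦ c zⁿ` of the punctured plane) —, `𝒜_• := ℂ` and
every induced isomorphism the identity (a holomorphic map acts on the linear germs `z ↦ p + a(z − p)` of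
Cor 2.7 (e) / abc-iut-w5-d225's plane model by conjugation, which preserves the multiplier `a`).  At
this `𝔄`, ALL AT ONCE (`exists_autHolFieldFunctor_prop42i_and_rmk421`):
* `EA` has a non-identity morphism (squaring) and **is id-rigid** — naturality along `z ↦ z²` forces a
  scalar `c` with `c² = c`, i.e. `c = 1`: it is the NON-INVERTIBLE finite étale morphisms that rigidify;
* **`Core EA` is NOT id-rigid** — `z ↦ −z` is a nontrivial automorphism commuting with every
  automorphism `z ↦ c·z` (abc-iut-w5-d226's `not_isIdRigid_core_of_central`);
* hence (abstract layer) `𝒞^hol_TF` and every `𝒞^hol_T`, `T ∈ {TM, TLG, TCG}`, over `𝔄` are id-rigid while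
  their cores are not — Prop 4.2 (i) and Rmk 4.2.1 side by side.

HONEST SCOPE: `ℂ^×` is not hyperbolic, let alone elliptically admissible; this certifies that the two
phenomena the abstract layer derives are JOINTLY and NON-TRIVIALLY realisable by an instance of the
interface with genuinely geometric composition law — not that the geometric `EA` of Cor 2.7 is
constructed.  Nothing here bears on [IUTchIII] Cor. 3.12.
-/

set_option autoImplicit false

namespace Literature.AnabelianGeometry.AbsoluteAnabelian

open _root_.CategoryTheory

/-- The composition law encoded below IS composition of the self-maps `z ↦ c·zⁿ` of `ℂ^×`:
`d·(c·zⁿ)ᵐ = (d·cᵐ)·zⁿᵐ`. [cite: MochizukiAbsTopIII2015, Remark 4.2.1 p.106] -/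
theorem puncturedPlane_comp_apply (c d z : ℂˣ) (n m : ℕ) :
    d * (c * z ^ n) ^ m = (d * c ^ m) * z ^ (n * m) := by
  rw [mul_pow, ← pow_mul, mul_assoc]

/-- **Kernel witness: Prop 4.2 (i) (id-rigidity of `EA`, `𝒞^hol_T`) and Rmk 4.2.1 (non-id-rigidity of the
groupoid versions) hold simultaneously and non-trivially at an instance of the interface** — `EA` the
one-object category of the maps `z ↦ c·zⁿ` (`c ∈ ℂ^×`, `n ≥ 1`) of `ℂ^×`, `𝒜 = ℂ`, induced isomorphisms the
identity. [cite: MochizukiAbsTopIII2015, Remark 4.2.1 p.106] -/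
theorem exists_autHolFieldFunctor_prop42i_and_rmk421 :
    ∃ 𝔄 : AutHolFieldFunctor.{0},
      (∃ X : 𝔄.EA, ∃ f : X ⟶ X, f ≠ 𝟙 X) ∧
      IsIdRigid 𝔄.EA ∧ ¬ IsIdRigid (Core 𝔄.EA) ∧
      IsIdRigid (HolTFPair 𝔄) ∧ ¬ IsIdRigid (Core (HolTFPair 𝔄)) ∧
      (∀ T : ArchPairType, T.IsMonoidType →
        IsIdRigid (HolMonoidPair 𝔄 T) ∧ ¬ IsIdRigid (Core (HolMonoidPair 𝔄 T))) := by
  -- the one-object category of the maps `z ↦ c·zⁿ`: a morphism is `(c, n) : ℂˣ × ℕ+`, `f ≫ g = g ∘ f`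
  letI catP : Category PUnit.{2} :=
    { Hom := fun _ _ => ULift.{1} (ℂˣ × ℕ+)
      id := fun _ => ⟨(1, 1)⟩
      comp := fun f g => ⟨(g.down.1 * f.down.1 ^ (g.down.2 : ℕ), f.down.2 * g.down.2)⟩
      id_comp := fun f => by
        apply ULift.ext
        simp
      comp_id := fun f => by
        apply ULift.ext
        simp
      assoc := fun f g h => by
        apply ULift.ext
        simp only [PNat.mul_coe, Prod.mk.injEq]
        exact ⟨by rw [mul_pow, ← pow_mul, mul_assoc, mul_comm (g.down.2 : ℕ)], mul_assoc _ _ _⟩ }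
  let 𝔄 : AutHolFieldFunctor.{0} :=
    { EA := PUnit.{2}, A := fun _ => ℂ, isCAF := fun _ => isCAF_complex,
      Amap := fun _ => RingEquiv.refl ℂ, continuous_Amap := fun _ => continuous_id,
      continuous_Amap_symm := fun _ => continuous_id, Amap_id := fun _ => rfl,
      Amap_comp := fun _ _ => rfl }
  -- bookkeeping in `EA`
  have comp_down : ∀ f g : (PUnit.unit : 𝔄.EA) ⟶ PUnit.unit,
      ULift.down (f ≫ g) =
        ((ULift.down g).1 * (ULift.down f).1 ^ ((ULift.down g).2 : ℕ), (ULift.down f).2 * (ULift.down g).2) :=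
    fun _ _ => rfl
  have id_down : ULift.down (𝟙 (PUnit.unit : 𝔄.EA)) = ((1 : ℂˣ), (1 : ℕ+)) := rfl
  -- an isomorphism has exponent `1`
  have iso_snd : ∀ e : (PUnit.unit : 𝔄.EA) ≅ PUnit.unit, (ULift.down e.hom).2 = 1 := by
    intro e
    have h := congrArg (fun k => ((ULift.down k).2 : ℕ)) e.hom_inv_id
    simp only [comp_down, id_down, PNat.mul_coe, PNat.one_coe] at h
    exact PNat.coe_inj.mp (by simpa using Nat.eq_one_of_mul_eq_one_right h)
  -- (1) a non-identity morphism: squaring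
  have h1 : ∃ X : 𝔄.EA, ∃ f : X ⟶ X, f ≠ 𝟙 X := by
    refine ⟨PUnit.unit, ⟨(1, 2)⟩, fun h => ?_⟩
    have := congrArg (fun k => ((ULift.down k).2 : ℕ)) h
    simp [id_down] at this
  -- (2) `EA` is id-rigid: naturality along squaring forces the scalar to be `1`
  have h2 : IsIdRigid 𝔄.EA := by
    intro α
    have hn : (ULift.down (α.hom.app PUnit.unit)).2 = 1 := iso_snd (α.app PUnit.unit)
    -- naturality of `α.hom` along the squaring map `(1, 2)`
    have hnat := congrArg ULift.down
      (α.hom.naturality (X := PUnit.unit) (Y := PUnit.unit) (⟨(1, 2)⟩ : (PUnit.unit : 𝔄.EA) ⟶ PUnit.unit))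
    simp only [Functor.id_map, comp_down, hn, PNat.one_coe, pow_one, mul_one, Prod.mk.injEq] at hnat
    -- `hnat.1 : c = 1 * c ^ 2`
    have hc : (ULift.down (α.hom.app PUnit.unit)).1 = 1 := by
      have h := hnat.1
      simp only [PNat.val_ofNat, one_mul] at h
      -- `c = c ^ 2` in a group forces `c = 1`
      have : (ULift.down (α.hom.app PUnit.unit)).1 * 1 =
          (ULift.down (α.hom.app PUnit.unit)).1 * (ULift.down (α.hom.app PUnit.unit)).1 := by
        rw [mul_one, ← pow_two]; exact h
      exact (mul_left_cancel this).symm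
    apply Iso.ext
    apply NatTrans.ext
    funext u
    cases u
    apply ULift.ext
    change ULift.down (α.hom.app PUnit.unit) = ULift.down (𝟙 (PUnit.unit : 𝔄.EA))
    rw [id_down, Prod.ext_iff]
    exact ⟨hc, hn⟩
  -- (3) `z ↦ −z` is a nontrivial central automorphism, so `Core EA` is not id-rigid
  let zneg : (PUnit.unit : 𝔄.EA) ≅ PUnit.unit :=
    { hom := ⟨(-1, 1)⟩, inv := ⟨(-1, 1)⟩,
      hom_inv_id := by apply ULift.ext; simp [comp_down, id_down]
      inv_hom_id := by apply ULift.ext; simp [comp_down, id_down] }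
  have hzneg : zneg ≠ Iso.refl _ := by
    intro h
    have := congrArg (fun e => ((ULift.down (Iso.hom e)).1 : ℂˣ)) h
    simp only [zneg, Iso.refl_hom, id_down] at this
    exact (by norm_num : (-1 : ℂˣ) ≠ 1) this
  have hcentral : ∀ g : (PUnit.unit : 𝔄.EA) ≅ PUnit.unit, g ≪≫ zneg = zneg ≪≫ g := by
    intro g
    have hg : (ULift.down g.hom).2 = 1 := iso_snd g
    apply Iso.ext
    apply ULift.ext
    change ULift.down (g.hom ≫ zneg.hom) = ULift.down (zneg.hom ≫ g.hom)
    rw [comp_down, comp_down, hg]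
    simp only [zneg, PNat.one_coe, pow_one, mul_one]
    rw [mul_comm]
  have h3 : ¬ IsIdRigid (Core 𝔄.EA) := not_isIdRigid_core_of_central PUnit.unit zneg hzneg hcentral
  refine ⟨𝔄, h1, h2, h3, HolTFPair.isIdRigid_of_isIdRigid_EA 𝔄 h2,
    HolTFPair.not_isIdRigid_core PUnit.unit zneg hzneg hcentral, fun T hT => ?_⟩
  exact ⟨HolMonoidPair.isIdRigid_of_isIdRigid_EA hT h2,
    HolMonoidPair.not_isIdRigid_core hT PUnit.unit zneg hzneg hcentral⟩

end Literature.AnabelianGeometry.AbsoluteAnabelian
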